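/-
Copyright (c) 2026 the pub-hodgecm-mathlib formalisation cell (harness21).  Prover seat hodgecm-mathlib-K2E2-p12 (g6): Track B «K2-LIT», ENGINE E1,
h413 = stmt-HodgeConjecture-24833; line `K2_E1_TraceFormulaBeta`, 5Res campaign «ENDGAME BY FAMILIES», amendment #3 G8, deal (269)∕ruling (270) (P1) of K2E1-plan (g7):
FILE 1 of the letter `hsymm_τ` — THE ABSTRACT WEYL SYMMETRY OF SYMBOLS ON A SECTION LINE: `R(h)` and an intertwining functional commute ⇒ `s(w)·c(w) = c(w)·s′(ρ₀ − w)` ⇒ `s = s′ ∘ (ρ₀ − ·)`.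
-/
import Mathlib.Analysis.Complex.CauchyIntegral
import Mathlib.Analysis.Analytic.IsolatedZeros
import Mathlib.MeasureTheory.Integral.Prod
import Mathlib.MeasureTheory.Group.Measure
import HarnessLib

/-!
# K2·E1 — `K2E1ArchSphericalTypeSymbolWeylSymmetryU2` (G8 FILE 1): THE WEYL SYMMETRY `s(z) = s′(ρ₀ − z)` OF HECKE SYMBOLS ON SECTION LINES FROM THE COMMUTATION OF `R(h)` WITH AN INTERTWINING
# FUNCTIONAL — ★ (G1) `K2E1SphericalTransformSymmetryU` §1 with the flat section `H^w` replaced by an ARBITRARY section family `A_w` (so that `K_∞`-types `τ` and arch characters `χ_∞` are covered)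
# [Mœglin–Waldspurger II.1.6–7, IV.1.10; Langlands LNM 544 §6; Garrett §2.8]

Track B ∕ K2-LIT, crux h413 = `stmt-HodgeConjecture-24833`, route of record `HCCMUnconditional`; cell `hodgecm-mathlib`, squad K2, ENGINE E1 (5Res campaign, M2 v2, amendment #3 «general (U,τ)
ladder» rung G8: the letter `hsymm_τ : s(½ − it) = s(½ + it)` of (y1-c)∕G9 at `dim V > 1`).  THEOREMS ONLY (no `def`, no `instance`, no notation, no named-fact hypothesis, no `sorry`; default
heartbeats); lane `--supports stmt-HodgeConjecture-24833 --as helper` (count-neutral).  CLOSES NO SOCKET.  Pure Mathlib (measure theory + one complex variable); no automorphic object.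

THE MECHANISM (★ (G1), K2E1-p10, for `τ = 1`; here abstract).  On a group `G` with a measure `μ`, a «section» `A : G → ℂ` on which the right convolution by `h` acts by a scalar,
`∫ h(y) A(x y) dμ(y) = s · A(x)` (`hR`; E1: ★ 12d-I∕12d-C — a `K_∞`-central `h_∞ ⊗ 𝟙_U` acts on the `(χ_∞‖·‖^w, τ)`-section line by the symbol `s(w)`), and an «intertwining functional»
`(M F)(x) = ∫ A(w₀ · ι v · x) dν(v)` over a measure space `(Nn, ν)` mapped into `G` (E1: `N(𝔸)` or `N_∞`, `w₀` the long Weyl element) with the SCALING LAW `M A = c · A′` onto a second section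
`A′` with symbol `s′` (`hscale`, `hR′`; E1: `A′` = the section at `(χ_∞ʷ, ρ₀ − w, τ)`).  Fubini gives **`s · c · A′(g) = c · s′ · A′(g)`** (§1), so `s = s′` wherever `c ≠ 0`, `A′(g) ≠ 0`; for
families `A_w, A′_w` with ENTIRE symbols `s, s′`, a scalar `c` continuous on an open `Ω` and non-zero somewhere on `Ω`, the identity principle gives **`s(z) = s′(ρ₀ − z)` for all `z`** (§2–§3).
SELF-DUAL COROLLARY (§4): when the reflected line has the SAME symbol function (`s′ = s`: E1 `χ_∞ʷ = χ_∞`, every SD block, every `K_∞`-character `τ`), `s(z) = s(ρ₀ − z)`, i.e. at `ρ₀ = 1`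
**`hsymm : ∀ t, s(½ − it) = s(½ + it)`** — K2E1-p11's (y1-c) letter.  Off-dual the honest statement is `s_χ(z) = s_{χʷ}(1 − z)` (§3), no symmetry.
* §1 **`symbol_mul_scalar_eq_of_commute`** — the commutation `s·c·A′(g) = c·s′·A′(g)` (letters `hR hR′ hscale` + ONE integrability letter `hint` for Fubini on `μ ⊗ ν`).
* §2 **`eq_comp_sub_of_mul_eq_mul`** — identity principle: `T, T′` entire, `c` continuous on open `Ω` with `c(w₁) ≠ 0` for some `w₁ ∈ Ω`, `T(w)c(w) = c(w)T′(ρ₀−w)` on `Ω` ⇒ `T = T′ ∘ (ρ₀ − ·)`.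
* §3 **`symbol_eq_symbol_reflect`** — families: `s(z) = s′(ρ₀ − z)`; §4 **`symbol_symm_of_selfDual`** (`s′ = s`) and **`hsymm_of_selfDual`** (`ρ₀ = 1`: `s(½ − it) = s(½ + it)`).
FILE 2 (the E1 discharge at `U(1,1)`: `hR` ★ 12d-C `exists_rightConvSection_eq_smul_of_arch`, `hscale` from the line property ★ 12d-I + the modulus computation of ★
`integral_borelHeight_weylLongU_mul_cpow_eq`, `hint` ★ `integrable_borelHeight_weylLongU_mul_rpow_cm_two` (`|A_w| = H^{Re w}`), and the ONE new analytic input `c_τ ≢ 0` on `{Re w > 1}` by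
Laplace concentration) is the successor file; here every E1 object is a letter.
HONEST LABEL: HC_CM is proved only modulo the 7 printed citations (2 remaining named inputs: hLiu418 = `stmt-HodgeConjecture-24832`, h413 = `stmt-HodgeConjecture-24833`) until rung 0
closes; this file asserts no named fact and closes no socket; count-neutral; unconditional (abstract).

## References
* [MoeglinWaldspurger1995] C. Mœglin, J.-L. Waldspurger, *Spectral decomposition and Eisenstein series* (1995): II.1.6–II.1.7 (intertwining operators commute with the Hecke action), IV.1.10.
* [Langlands1976] R. P. Langlands, *On the Functional Equations Satisfied by Eisenstein Series*, LNM 544 (1976): §6.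
* [Garrett2018] P. Garrett, *Modern Analysis of Automorphic Forms by Example* (2018): §2.8 (the symmetry `s ↦ 1 − s` of spherical eigenvalues via intertwinings).
-/

set_option autoImplicit false
set_option linter.dupNamespace false -- the mandated namespace repeats `HodgeConjecture.HodgeConjecture`

noncomputable section

open MeasureTheory Filter Topology Set Function

namespace Summit.HodgeConjecture.HodgeConjecture.Cruxes.H413.K2E1ArchSphericalTypeSymbolWeylSymmetryU2

/-! ## §1 The commutation of `R(h)` with the intertwining functional on a section line -/

section Commute

variable {G Nn : Type*} [Group G] [MeasurableSpace G] [MeasurableSpace Nn] (μ : Measure G) (ν : Measure Nn) [SFinite μ] [SFinite ν]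

/-- **`s · c · A′(g) = c · s′ · A′(g)`**: if the right convolution by `h` acts on the section `A` by the scalar `s` (`hR`) and on `A′` by `s′` (`hR′`), and the intertwining functional
`x ↦ ∫ A(w₀ · ι v · x) dν(v)` maps `A` to `c · A′` (`hscale`), then — by Fubini on `μ ⊗ ν` (integrability letter `hint` at the base point `g`) — `s · c · A′(g) = c · s′ · A′(g)`:
`∫_G h(y) ∫_N A(w₀ v g y) = c·∫_G h(y)A′(gy) = c·s′·A′(g)` and `= ∫_N ∫_G h(y)A(w₀vg·y) = ∫_N s·A(w₀vg) = s·c·A′(g)`. [cite: MoeglinWaldspurger1995, II.1.6–II.1.7] [cite: Langlands1976, §6] -/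
theorem symbol_mul_scalar_eq_of_commute (ι : Nn → G) (w₀ g : G) (h A A' : G → ℂ) (s s' cw : ℂ)
    (hR : ∀ x : G, ∫ y, h y * A (x * y) ∂μ = s * A x) (hR' : ∀ x : G, ∫ y, h y * A' (x * y) ∂μ = s' * A' x)
    (hscale : ∀ x : G, ∫ v, A (w₀ * ι v * x) ∂ν = cw * A' x)
    (hint : Integrable (uncurry fun (y : G) (v : Nn) => h y * A (w₀ * ι v * (g * y))) (μ.prod ν)) :
    s * cw * A' g = cw * s' * A' g := by
  -- the double integral, computed in the two orders
  have hswap : ∫ y, ∫ v, h y * A (w₀ * ι v * (g * y)) ∂ν ∂μ = ∫ v, ∫ y, h y * A (w₀ * ι v * (g * y)) ∂μ ∂ν := integral_integral_swap hint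
  have houter : ∀ y, ∫ v, h y * A (w₀ * ι v * (g * y)) ∂ν = h y * (cw * A' (g * y)) := fun y => by
    rw [integral_const_mul, hscale (g * y)]
  have hinner : ∀ v, ∫ y, h y * A (w₀ * ι v * (g * y)) ∂μ = s * A (w₀ * ι v * g) := fun v => by
    have e : (fun y => h y * A (w₀ * ι v * (g * y))) = fun y => h y * A (w₀ * ι v * g * y) := funext fun y => by rw [mul_assoc (w₀ * ι v)]
    rw [e, hR]
  have lhs : ∫ y, ∫ v, h y * A (w₀ * ι v * (g * y)) ∂ν ∂μ = cw * s' * A' g := by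
    rw [integral_congr_ae (Eventually.of_forall houter)]
    have e : (fun y => h y * (cw * A' (g * y))) = fun y => cw * (h y * A' (g * y)) := funext fun y => by ring
    rw [e, integral_const_mul, hR' g, mul_assoc]
  have rhs : ∫ v, ∫ y, h y * A (w₀ * ι v * (g * y)) ∂μ ∂ν = s * cw * A' g := by
    rw [integral_congr_ae (Eventually.of_forall hinner), integral_const_mul, hscale g, mul_assoc]
  rw [← rhs, ← hswap, lhs]

end Commute

/-! ## §2 The identity principle step -/

/-- **IDENTITY PRINCIPLE**: `T, T′` entire, `c` continuous on an open set `Ω` and `c(w₁) ≠ 0` for some `w₁ ∈ Ω`, and `T(w)·c(w) = c(w)·T′(ρ₀ − w)` on `Ω` ⇒ `T(z) = T′(ρ₀ − z)` for every `z`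
(the two entire functions agree on the non-empty open set `Ω ∩ {c ≠ 0}`). [cite: MoeglinWaldspurger1995, IV.1.10] [cite: Garrett2018, §2.8] -/
theorem eq_comp_sub_of_mul_eq_mul (T T' c : ℂ → ℂ) (ρ₀ : ℂ) (hT : Differentiable ℂ T) (hT' : Differentiable ℂ T')
    {Ω : Set ℂ} (hΩ : IsOpen Ω) (hc : ContinuousOn c Ω) (h0 : ∃ w₁ ∈ Ω, c w₁ ≠ 0) (hcomm : ∀ w ∈ Ω, T w * c w = c w * T' (ρ₀ - w)) (z : ℂ) :
    T z = T' (ρ₀ - z) := by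
  have hT'd : Differentiable ℂ (fun w => T' (ρ₀ - w)) := hT'.comp ((differentiable_const _).sub differentiable_id)
  set U : Set ℂ := Ω ∩ c ⁻¹' {0}ᶜ with hU
  have hUo : IsOpen U := hc.isOpen_inter_preimage hΩ isOpen_compl_singleton
  obtain ⟨w₁, hw₁, hcw₁⟩ := h0
  have hw₁U : w₁ ∈ U := ⟨hw₁, hcw₁⟩
  have hUeq : ∀ w ∈ U, T w = T' (ρ₀ - w) := fun w hw => by
    have key : T w * c w = T' (ρ₀ - w) * c w := by rw [hcomm w hw.1, mul_comm]
    exact mul_right_cancel₀ hw.2 key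
  have hTeq : T = fun w => T' (ρ₀ - w) :=
    AnalyticOnNhd.eq_of_eventuallyEq (hT.differentiableOn.analyticOnNhd isOpen_univ) (hT'd.differentiableOn.analyticOnNhd isOpen_univ) (eventuallyEq_of_mem (hUo.mem_nhds hw₁U) hUeq)
  exact congrFun hTeq z

/-! ## §3 Families: the Weyl symmetry `s(z) = s′(ρ₀ − z)` -/

section Families

variable {G Nn : Type*} [Group G] [MeasurableSpace G] [MeasurableSpace Nn] (μ : Measure G) (ν : Measure Nn) [SFinite μ] [SFinite ν]

/-- **THE WEYL SYMMETRY OF SYMBOLS ON SECTION LINES**: section families `A_w, A′_w : G → ℂ` (`w ∈ ℂ`) with ENTIRE symbols `s, s′` under the right convolution by `h` (`hR`, `hR′`), an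
intertwining functional with the scaling law `∫ A_w(w₀ ι v x) dν = c(w)·A′_{ρ₀−w}(x)` on an open `Ω` (`hscale`), Fubini integrability at a base point `g` with `A′_{ρ₀−w}(g) ≠ 0` (`hint`, `hA′`),
`c` continuous on `Ω` and non-zero somewhere on `Ω` ⇒ **`s(z) = s′(ρ₀ − z)` for every `z`**.  E1: `s = s_{χ_∞,τ}`, `s′ = s_{χ_∞ʷ,τ}` — the symbol of a `K_∞`-central `h_∞` on the
`(χ,z,τ)`-line equals the reflected symbol at `ρ₀ − z`. [cite: MoeglinWaldspurger1995, II.1.6–II.1.7, IV.1.10] [cite: Langlands1976, §6] [cite: Garrett2018, §2.8] -/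
theorem symbol_eq_symbol_reflect (ι : Nn → G) (w₀ g : G) (h : G → ℂ) (A A' : ℂ → G → ℂ) (s s' c : ℂ → ℂ) (ρ₀ : ℂ)
    (hs : Differentiable ℂ s) (hs' : Differentiable ℂ s')
    {Ω : Set ℂ} (hΩ : IsOpen Ω) (hc : ContinuousOn c Ω) (h0 : ∃ w₁ ∈ Ω, c w₁ ≠ 0)
    (hR : ∀ w ∈ Ω, ∀ x : G, ∫ y, h y * A w (x * y) ∂μ = s w * A w x)
    (hR' : ∀ w ∈ Ω, ∀ x : G, ∫ y, h y * A' (ρ₀ - w) (x * y) ∂μ = s' (ρ₀ - w) * A' (ρ₀ - w) x)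
    (hscale : ∀ w ∈ Ω, ∀ x : G, ∫ v, A w (w₀ * ι v * x) ∂ν = c w * A' (ρ₀ - w) x)
    (hint : ∀ w ∈ Ω, Integrable (uncurry fun (y : G) (v : Nn) => h y * A w (w₀ * ι v * (g * y))) (μ.prod ν))
    (hA' : ∀ w ∈ Ω, A' (ρ₀ - w) g ≠ 0) (z : ℂ) :
    s z = s' (ρ₀ - z) := by
  refine eq_comp_sub_of_mul_eq_mul s s' c ρ₀ hs hs' hΩ hc h0 (fun w hw => ?_) z
  have key := symbol_mul_scalar_eq_of_commute μ ν ι w₀ g h (A w) (A' (ρ₀ - w)) (s w) (s' (ρ₀ - w)) (c w) (hR w hw) (hR' w hw) (hscale w hw) (hint w hw)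
  -- cancel `A′_{ρ₀−w}(g) ≠ 0`
  have key' : s w * c w * A' (ρ₀ - w) g = c w * s' (ρ₀ - w) * A' (ρ₀ - w) g := key
  exact mul_right_cancel₀ (hA' w hw) key'

/-! ## §4 The self-dual corollary: `s(z) = s(ρ₀ − z)` and `hsymm` -/

/-- **SELF-DUAL LINES: `s(z) = s(ρ₀ − z)`** — when the reflected family carries the SAME symbol function (`s′ = s`; E1: `χ_∞ʷ = χ_∞`, every self-dual block, every `K_∞`-character `τ`).
[cite: MoeglinWaldspurger1995, IV.1.10] [cite: Garrett2018, §2.8] -/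
theorem symbol_symm_of_selfDual (ι : Nn → G) (w₀ g : G) (h : G → ℂ) (A A' : ℂ → G → ℂ) (s c : ℂ → ℂ) (ρ₀ : ℂ) (hs : Differentiable ℂ s)
    {Ω : Set ℂ} (hΩ : IsOpen Ω) (hc : ContinuousOn c Ω) (h0 : ∃ w₁ ∈ Ω, c w₁ ≠ 0)
    (hR : ∀ w ∈ Ω, ∀ x : G, ∫ y, h y * A w (x * y) ∂μ = s w * A w x)
    (hR' : ∀ w ∈ Ω, ∀ x : G, ∫ y, h y * A' (ρ₀ - w) (x * y) ∂μ = s (ρ₀ - w) * A' (ρ₀ - w) x)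
    (hscale : ∀ w ∈ Ω, ∀ x : G, ∫ v, A w (w₀ * ι v * x) ∂ν = c w * A' (ρ₀ - w) x)
    (hint : ∀ w ∈ Ω, Integrable (uncurry fun (y : G) (v : Nn) => h y * A w (w₀ * ι v * (g * y))) (μ.prod ν))
    (hA' : ∀ w ∈ Ω, A' (ρ₀ - w) g ≠ 0) (z : ℂ) :
    s z = s (ρ₀ - z) :=
  symbol_eq_symbol_reflect μ ν ι w₀ g h A A' s s c ρ₀ hs hs hΩ hc h0 hR hR' hscale hint hA' z

/-- **`hsymm` — K2E1-p11's (y1-c) letter** at `ρ₀ = 1`: `∀ t, s(½ − it) = s(½ + it)` on a self-dual line (§4 at `z = ½ + it`: `1 − (½ + it) = ½ − it`).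
[cite: MoeglinWaldspurger1995, IV.1.10] [cite: Garrett2018, §2.8] -/
theorem hsymm_of_selfDual (ι : Nn → G) (w₀ g : G) (h : G → ℂ) (A A' : ℂ → G → ℂ) (s c : ℂ → ℂ) (hs : Differentiable ℂ s)
    {Ω : Set ℂ} (hΩ : IsOpen Ω) (hc : ContinuousOn c Ω) (h0 : ∃ w₁ ∈ Ω, c w₁ ≠ 0)
    (hR : ∀ w ∈ Ω, ∀ x : G, ∫ y, h y * A w (x * y) ∂μ = s w * A w x)
    (hR' : ∀ w ∈ Ω, ∀ x : G, ∫ y, h y * A' (1 - w) (x * y) ∂μ = s (1 - w) * A' (1 - w) x)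
    (hscale : ∀ w ∈ Ω, ∀ x : G, ∫ v, A w (w₀ * ι v * x) ∂ν = c w * A' (1 - w) x)
    (hint : ∀ w ∈ Ω, Integrable (uncurry fun (y : G) (v : Nn) => h y * A w (w₀ * ι v * (g * y))) (μ.prod ν))
    (hA' : ∀ w ∈ Ω, A' (1 - w) g ≠ 0) (t : ℝ) :
    s (1 / 2 - t * Complex.I) = s (1 / 2 + t * Complex.I) := by
  have h1 := symbol_symm_of_selfDual μ ν ι w₀ g h A A' s c 1 hs hΩ hc h0 hR hR' hscale hint hA' (1 / 2 + t * Complex.I)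
  rw [h1]
  congr 1
  ring

end Families

end Summit.HodgeConjecture.HodgeConjecture.Cruxes.H413.K2E1ArchSphericalTypeSymbolWeylSymmetryU2

end
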